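import Literature.NumberTheory.LFunctions.MatomakiRadziwillTaoKeyEstimate
import HarnessLib

/-!
# Matomäki–Radziwiłł–Tao 2015, Theorem 1.7 from Theorem A.2

K. Matomäki, M. Radziwiłł, T. Tao, *An averaged form of Chowla's conjecture*, Algebra & Number
Theory **9** (2015), 2167–2196 (arXiv:1503.05121), §2, "Proof of Theorem 1.7 assuming
Theorem 2.3".  Everything in this file is PROVED from the named fact
`Literature.NumberTheory.LFunctions.MatomakiRadziwillTao2015_theoremA2` (the complex
Matomäki–Radziwiłł theorem, Appendix A), through Theorem 2.3 in discrete form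
(`MRT2015.keyEstimate_typ`, `MatomakiRadziwillTaoKeyEstimate.lean`, itself from
`MRT2015.prop24_discrete`, `MRT2015.majorArc_le`, `MRT2015.minorArc_bilinear_le`) and Lemma 2.2
(`MRT2015.lemma22`, `MatomakiRadziwillTaoTypical.lean`).  The main result closes the gap between
Theorem A.2 and the named fact `Literature.NumberTheory.LFunctions.MatomakiRadziwillTao2015_theorem17`
(MRT 2015, Theorem 1.7), the only remaining named input of the tree's proof of Tao's
logarithmically averaged Chowla–Elliott theorem (`TaoLogElliottOfMRT.lean`,
`TaoLogChowlaTwoAssembly.lean`):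

* `MRT2015.windows_full_le` — the window family of the FULL function in the regime `W = log⁵ L`:
  `∑_{x ≤ X₃} |∑_{x<n≤x+L} g(n) e(αn)| ≤ C L X₃ log log L / log L` (Theorem 2.3 for the typical
  part, Lemma 2.2 for the rest), under `L ≥ L₀`, `log L ≤ (log X)^{1/625}`,
  `15 log log L ≤ M(g; X, log⁵ L)`, `X ≤ X₃ ≤ 2X`;
* `MRT2015.family_split_le` (balanced pieces `MRT2015.pieceEnd`) — the covering of long windows by
  admissible ones ("Covering `[0,H]` by `O(H/H₀)` intervals of length `H₀`");
* `MRT2015.integral_le_sum_windows` — from `∫_0^X … dx` to integer windows: for `k < x ≤ k + 1` the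
  integers of `[x, x + H]` are `(k, k + t]`, `t ∈ {⌊H⌋, ⌊H⌋ + 1}`;
* `MRT2015.theorem17_mainRegime`, `MRT2015.MatomakiRadziwillTao2015_theorem17_of_theoremA2` —
  **Theorem 1.7 from Theorem A.2**:
  `MatomakiRadziwillTao2015_theoremA2 → MatomakiRadziwillTao2015_theorem17`.

## References
* [MRT2015] K. Matomäki, M. Radziwiłł, T. Tao, Algebra & Number Theory 9 (2015), 2167–2196, §2
  ("Proof of Theorem 1.7 assuming Theorem 2.3"; Lemma 2.2; Theorem 2.3).
  [cite: MatomakiRadziwillTao2015, Theorem 1.7]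

## Design choices / deviations from the printed argument
* For `k < x ≤ k + 1` the integrand is one of the two window sums `(k, k + ⌊H⌋]`,
  `(k, k + ⌊H⌋ + 1]`, the second only when `k + ⌊H⌋ + 1 ≤ ⌊X + H⌋`, so all windows stay below
  `X₃ = X + H ≤ 2X` (the height at which Lemma 2.2 and Theorem 2.3 are applied, the
  non-pretentiousness hypothesis living at height `X`).
* Each window of length `t ∈ {⌊H⌋, ⌊H⌋+1}` is split into `m = max(2, ⌈2(⌊H⌋+1)/σ⌉)` balanced
  pieces, `log σ = min(log^{1/700} X · log log X, M e^{M/20})` (the paper's `log H₀`); `m ≥ 2`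
  keeps the piece lengths `s ≤ H`, so that `log⁵ s ≤ log⁵ H` and the level
  `Q = min(log^{1/125} X, log⁵ H)` of the statement dominates `log⁵ s`; since `M(g; X, ·)` is
  non-increasing in the level (`MRT2015.nonpretentiousness_mono_level`), the hypothesis
  `M(g; X, log⁵ s) ≥ 15 log log s` of `windows_full_le` follows from `M(g; X, Q) = M` large.  This
  replaces the paper's "the quantity … is unchanged up to multiplicative constants if one reduces
  `H` to `H₀`" and "`M(g; X+H, Q) = M(g; X, Q) + O(1)`".
* The ranges where `X`, `H` or `M` is bounded are covered by the trivial bound `(H + 2) X`, the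
  corresponding term of the right-hand side being bounded below there ("We may assume that `X`,
  `H`, and `M(g;X,Q)` are larger than any specified absolute constant, as the claim is trivial
  otherwise").  Constants are explicit but not optimised.
-/

noncomputable section

open Finset Real
open scoped Classical FourierTransform

namespace Literature.NumberTheory.LFunctions

namespace MRT2015

/-! ### Exchanging the window variable and the summation variable -/

/-- Each `n` lies in at most `L` of the windows `x < d n ≤ x + L`:
`∑_{x ≤ N} ∑_{x/d < n ≤ (x+L)/d, dn ≤ N} w(n) ≤ L ∑_{1 ≤ n ≤ N/d} w(n)` for `w ≥ 0`
("after moving the absolute values inside the summation and then performing the integration on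
`x` first", [MRT2015, §2]). [cite: MatomakiRadziwillTao2015, §2 (proof of Theorem 2.3)] -/
theorem sum_window_le_mul_sum {d : ℕ} (hd : 0 < d) (N L : ℕ) (w : ℕ → ℝ) (hw : ∀ n, 0 ≤ w n) :
    ∑ x ∈ range (N + 1), ∑ n ∈ Ioc (x / d) ((x + L) / d), (if d * n ≤ N then w n else 0) ≤
      L * ∑ n ∈ Icc 1 (N / d), w n := by
  have h1 : ∀ x, ∑ n ∈ Ioc (x / d) ((x + L) / d), (if d * n ≤ N then w n else 0) =
      ∑ n ∈ Icc 1 (N / d), if x < d * n ∧ d * n ≤ x + L then w n else 0 := by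
    intro x
    rw [← Finset.sum_filter, ← Finset.sum_filter]
    refine Finset.sum_congr ?_ (fun _ _ => rfl)
    ext n
    simp only [Finset.mem_filter, Finset.mem_Ioc, Finset.mem_Icc, Nat.div_lt_iff_lt_mul hd,
      Nat.le_div_iff_mul_le hd]
    constructor
    · rintro ⟨⟨h1, h2⟩, h3⟩
      refine ⟨⟨?_, by linarith [mul_comm n d]⟩, by linarith [mul_comm n d], by linarith [mul_comm n d]⟩
      rcases Nat.eq_zero_or_pos n with rfl | hn
      · simp at h1
      · exact hn
    · rintro ⟨⟨-, h2⟩, h3, h4⟩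
      exact ⟨⟨by linarith [mul_comm n d], by linarith [mul_comm n d]⟩, by linarith [mul_comm n d]⟩
  rw [Finset.sum_congr rfl (fun x _ => h1 x), Finset.sum_comm, Finset.mul_sum]
  refine Finset.sum_le_sum fun n _ => ?_
  rw [← Finset.sum_filter, Finset.sum_const, nsmul_eq_mul]
  refine mul_le_mul_of_nonneg_right ?_ (hw n)
  have hsub : (range (N + 1)).filter (fun x => x < d * n ∧ d * n ≤ x + L) ⊆ Ico (d * n - L) (d * n) := by
    intro x hx
    rw [Finset.mem_filter] at hx
    rw [Finset.mem_Ico]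
    omega
  calc (#((range (N + 1)).filter (fun x => x < d * n ∧ d * n ≤ x + L)) : ℝ)
      ≤ #(Ico (d * n - L) (d * n)) := by exact_mod_cast Finset.card_le_card hsub
    _ ≤ L := by rw [Nat.card_Ico]; exact_mod_cast (by omega : d * n - (d * n - L) ≤ L)


/-! ## Windows of the full function in the regime `W = log⁵ L`

With `V := log L` in `keyEstimate_typ` (Theorem 2.3) the typical part of the windows is
`≪ L X₃ / log L`, and by Lemma 2.2 the integers without typical factorization contribute
`≪ (log log L / log L) L X₃` ("from Lemma 2.2, the choice of `W, P₁, Q₁`, and the bound on `H`",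
[MRT2015, §2, proof of Theorem 1.7]). -/

/-- Monotonicity of `M(g; X, Q)` in the level: `M(g; X, Q) ≤ M(g; X, W)` for `1 ≤ W ≤ Q`
(an infimum over more characters is smaller), `g` `1`-bounded, `X ≥ 0`.
[cite: MatomakiRadziwillTao2015, §1.1 (definition of `M(g; X, Q)`)] -/
theorem nonpretentiousness_mono_level {g : ℕ → ℂ} (hg : ∀ n, ‖g n‖ ≤ 1) {X W Q : ℝ}
    (hX : 0 ≤ X) (hW : 1 ≤ W) (hWQ : W ≤ Q) :
    Sieve.nonpretentiousness g X Q ≤ Sieve.nonpretentiousness g X W := by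
  unfold Sieve.nonpretentiousness
  have hne : Nonempty (Set.Icc 1 ⌊W⌋₊) := ⟨⟨1, Set.mem_Icc.mpr ⟨le_rfl, Nat.le_floor (by simpa using hW)⟩⟩⟩
  refine le_ciInf fun q => ?_
  have hq : (q : ℕ) ∈ Set.Icc 1 ⌊Q⌋₊ :=
    ⟨q.2.1, q.2.2.trans (Nat.floor_le_floor hWQ)⟩
  have hbdd : BddBelow (Set.range fun q' : Set.Icc 1 ⌊Q⌋₊ =>
      ⨅ χ : DirichletCharacter ℂ (q' : ℕ), Sieve.charNonpretentiousness g χ X) := by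
    refine ⟨0, ?_⟩
    rintro _ ⟨q', rfl⟩
    exact Sieve.iInf_charNonpretentiousness_nonneg hg _ hX
  exact ciInf_le hbdd ⟨q, hq⟩

/-- Thresholds in `L` used with `W = log⁵ L`: for `L ≥ L₀`, `log L ≥ exp 2`,
`2 log^{1015} L ≤ L` and `30 log log L ≤ log L`. [folklore] -/
theorem exists_threshold_L : ∃ L₀ : ℝ, ∀ L : ℝ, L₀ ≤ L →
    Real.exp 2 ≤ Real.log L ∧ 2 * Real.log L ^ 1015 ≤ L ∧ 30 * Real.log (Real.log L) ≤ Real.log L := by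
  have h1 : ∀ᶠ L : ℝ in Filter.atTop, 2 * Real.log L ^ 1015 ≤ L := by
    have ht := Real.tendsto_pow_log_div_mul_add_atTop 1 0 1015 one_ne_zero
    have he := ht.eventually (gt_mem_nhds (show (0 : ℝ) < 1 / 2 by norm_num))
    filter_upwards [he, Filter.eventually_gt_atTop (0 : ℝ)] with L hL hL0
    rw [one_mul, add_zero, div_lt_iff₀ hL0] at hL
    linarith
  have h2 : ∀ᶠ L : ℝ in Filter.atTop, 30 * Real.log (Real.log L) ≤ Real.log L := by
    have ht := Real.tendsto_pow_log_div_mul_add_atTop 1 0 1 one_ne_zero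
    have he := ht.eventually (gt_mem_nhds (show (0 : ℝ) < 1 / 30 by norm_num))
    have hu : ∀ᶠ u : ℝ in Filter.atTop, 30 * Real.log u ≤ u := by
      filter_upwards [he, Filter.eventually_gt_atTop (0 : ℝ)] with u hu hu0
      rw [one_mul, add_zero, pow_one, div_lt_iff₀ hu0] at hu
      linarith
    exact Real.tendsto_log_atTop.eventually hu
  have h3 : ∀ᶠ L : ℝ in Filter.atTop, Real.exp 2 ≤ Real.log L :=
    Real.tendsto_log_atTop.eventually (Filter.eventually_ge_atTop _)
  obtain ⟨L₀, hL₀⟩ := Filter.eventually_atTop.mp (h3.and (h1.and h2))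
  exact ⟨L₀, fun L hL => hL₀ L hL⟩

/-- The overshoot of the windows beyond `N`: `∑_{x ≤ N} #{x < n ≤ x + L : n > N} ≤ L²`.
[folklore] -/
theorem sum_card_overshoot_le (N L : ℕ) :
    ∑ x ∈ range (N + 1), (#((Ioc x (x + L)).filter (fun n => N < n)) : ℝ) ≤ (L : ℝ) ^ 2 := by
  have h1 : ∀ x ∈ range (N + 1), (#((Ioc x (x + L)).filter (fun n => N < n)) : ℝ) ≤
      if N < x + L then (L : ℝ) else 0 := by
    intro x _
    split_ifs with h
    · calc (#((Ioc x (x + L)).filter (fun n => N < n)) : ℝ) ≤ #(Ioc x (x + L)) := by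
            exact_mod_cast Finset.card_filter_le _ _
        _ = L := by simp
    · have : (Ioc x (x + L)).filter (fun n => N < n) = ∅ := by
        refine Finset.filter_false_of_mem fun n hn => ?_
        rw [Finset.mem_Ioc] at hn; omega
      rw [this]; simp
  refine (Finset.sum_le_sum h1).trans ?_
  rw [← Finset.sum_filter, Finset.sum_const, nsmul_eq_mul, sq]
  refine mul_le_mul_of_nonneg_right ?_ (Nat.cast_nonneg L)
  have hsub : (range (N + 1)).filter (fun x => N < x + L) ⊆ Ico (N + 1 - L) (N + 1) := by
    intro x hx
    rw [Finset.mem_filter, Finset.mem_range] at hx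
    rw [Finset.mem_Ico]; omega
  calc (#((range (N + 1)).filter (fun x => N < x + L)) : ℝ) ≤ #(Ico (N + 1 - L) (N + 1)) := by
        exact_mod_cast Finset.card_le_card hsub
    _ ≤ L := by rw [Nat.card_Ico]; exact_mod_cast (by omega : N + 1 - (N + 1 - L) ≤ L)

/-- The integers `≤ N` without typical factorization meet at most `L` windows each:
`∑_{x ≤ N} #{x < n ≤ x+L : n ≤ N, ¬typical(n)} ≤ L · #{1 ≤ n ≤ N : ¬typical(n)}`. [folklore] -/
theorem sum_card_not_typical_le (P₁ Q₁ X₀ : ℝ) (N L : ℕ) :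
    ∑ x ∈ range (N + 1), (#((Ioc x (x + L)).filter (fun n => n ≤ N ∧ ¬ IsTypical P₁ Q₁ X₀ n)) : ℝ) ≤
      L * #((Icc 1 N).filter (fun n => ¬ IsTypical P₁ Q₁ X₀ n)) := by
  have h := sum_window_le_mul_sum (d := 1) Nat.one_pos N L
    (fun n => if IsTypical P₁ Q₁ X₀ n then 0 else 1) (fun n => by positivity)
  simp only [Nat.div_one, one_mul] at h
  convert h using 2 with x
  · rw [Finset.card_filter]
    push_cast
    refine Finset.sum_congr rfl fun n _ => ?_
    by_cases h1 : n ≤ N <;> by_cases h2 : IsTypical P₁ Q₁ X₀ n <;> simp [h1, h2]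
  · rw [Finset.card_filter]
    push_cast
    refine Finset.sum_congr rfl fun n _ => ?_
    by_cases h2 : IsTypical P₁ Q₁ X₀ n <;> simp [h2]

/-- Elementary `rpow` facts for `u ≥ 16`: `u^{1/625} ≤ √u / 2` (hence `4 u^{1/625} ≤ u` and
`u^{1/625} ≤ √(u/2)`). [folklore] -/
theorem rpow_small_le_sqrt {u : ℝ} (hu : 16 ≤ u) :
    u ^ (1 / 625 : ℝ) ≤ Real.sqrt u / 2 ∧ 4 * u ^ (1 / 625 : ℝ) ≤ u ∧
      u ^ (1 / 625 : ℝ) ≤ Real.sqrt (u / 2) := by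
  have hu0 : 0 < u := by linarith
  have hu1 : 1 ≤ u := by linarith
  have h4 : (2 : ℝ) ≤ u ^ (1 / 4 : ℝ) := by
    have : (16 : ℝ) ^ (1 / 4 : ℝ) = 2 := by
      rw [show (16 : ℝ) = 2 ^ (4 : ℕ) by norm_num, show (1 / 4 : ℝ) = ((4 : ℕ) : ℝ)⁻¹ by norm_num,
        Real.pow_rpow_inv_natCast (by norm_num) (by norm_num)]
    rw [← this]
    exact Real.rpow_le_rpow (by norm_num) hu (by norm_num)
  have h1 : u ^ (1 / 625 : ℝ) ≤ u ^ (1 / 4 : ℝ) :=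
    Real.rpow_le_rpow_of_exponent_le hu1 (by norm_num)
  have h2 : u ^ (1 / 4 : ℝ) * u ^ (1 / 4 : ℝ) = Real.sqrt u := by
    rw [← Real.rpow_add hu0, Real.sqrt_eq_rpow]; norm_num
  have hq0 : 0 ≤ u ^ (1 / 4 : ℝ) := by positivity
  have hA : u ^ (1 / 625 : ℝ) ≤ Real.sqrt u / 2 := by
    rw [le_div_iff₀ (by norm_num : (0 : ℝ) < 2), ← h2]
    nlinarith
  have hsq : Real.sqrt u * Real.sqrt u = u := Real.mul_self_sqrt hu0.le
  have hs4 : 4 ≤ Real.sqrt u := by rw [← h2]; nlinarith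
  refine ⟨hA, ?_, ?_⟩
  · nlinarith [Real.sqrt_nonneg u]
  · refine hA.trans ?_
    rw [Real.sqrt_div' u zero_le_two, div_le_div_iff_of_pos_left (by positivity) (by norm_num)
      (Real.sqrt_pos.mpr (by norm_num))]
    have := Real.sqrt_le_sqrt (show (2 : ℝ) ≤ 4 by norm_num)
    rw [show Real.sqrt 4 = 2 by rw [show (4 : ℝ) = 2 ^ 2 by norm_num, Real.sqrt_sq zero_le_two]] at this
    exact this

set_option maxHeartbeats 1600000 in
/-- **The window family of the full function in the regime `W = log⁵ L`** ([MRT2015, §2, proof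
of Theorem 1.7, case `H ≤ H₀`]): for `1`-bounded multiplicative `g`, `L ≥ L₀`,
`log L ≤ (log X)^{1/625}` and `M(g; X, log⁵ L) ≥ 15 log log L`,
`∑_{x ≤ X₃} |∑_{x < n ≤ x+L} g(n) e(αn)| ≤ C L X₃ log log L / log L` (`X ≤ X₃ ≤ 2X`, `X ≥ X_*`):
Theorem 2.3 (`keyEstimate_typ` with `V = log L`) for the typical part and Lemma 2.2
(`lemma22`) for the rest. [cite: MatomakiRadziwillTao2015, §2 (proof of Theorem 1.7)] -/
theorem windows_full_le (hA2 : MatomakiRadziwillTao2015_theoremA2) :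
    ∃ C L₀ Xs : ℝ, 0 < C ∧ ∀ (X X₃ : ℝ) (L : ℕ) (α : ℝ) (g : ArithmeticFunction ℂ),
      g.IsMultiplicative → (∀ n, ‖g n‖ ≤ 1) →
      Xs ≤ X → X ≤ X₃ → X₃ ≤ 2 * X → L₀ ≤ L →
      Real.log L ≤ Real.log X ^ (1 / 625 : ℝ) →
      15 * Real.log (Real.log L) ≤ Sieve.nonpretentiousness g X (Real.log L ^ 5) →
      ∑ x ∈ range (⌊X₃⌋₊ + 1), ‖∑ n ∈ Ioc x (x + L), g n * (𝐞 (α * n) : ℂ)‖ ≤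
        C * L * X₃ * (Real.log (Real.log L) / Real.log L) := by
  obtain ⟨C₁, W₁, X₁, hC₁, hkey⟩ := keyEstimate_typ hA2
  obtain ⟨C₂, X₂, hC₂, h22⟩ := lemma22
  obtain ⟨L₁, hL₁⟩ := exists_threshold_L
  refine ⟨C₁ + 2000 * C₂ + 1, max L₁ (Real.exp (max W₁ 3)), max (max X₁ X₂) (Real.exp 5776),
    by positivity, ?_⟩
  intro X X₃ L α g hgm hg1 hXs hXX₃ hX₃ hL₀ hLX hM
  -- thresholds in `L`
  obtain ⟨hl_e2, hl_1015, hl_30⟩ := hL₁ L ((le_max_left _ _).trans hL₀)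
  have hLexpW : Real.exp (max W₁ 3) ≤ L := (le_max_right _ _).trans hL₀
  have hL0 : (0 : ℝ) < L := (Real.exp_pos _).trans_le hLexpW
  set lam : ℝ := Real.log L with hlam
  have hl_W : max W₁ 3 ≤ lam := by
    rw [hlam, ← Real.log_exp (max W₁ 3)]; exact Real.log_le_log (Real.exp_pos _) hLexpW
  have hl_3 : 3 ≤ lam := (le_max_right _ _).trans hl_W
  have hl_7 : 7 ≤ lam := by
    have h := Real.exp_one_gt_d9
    have e : Real.exp 2 = Real.exp 1 * Real.exp 1 := by rw [← Real.exp_add]; norm_num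
    have : (7 : ℝ) ≤ Real.exp 2 := by rw [e]; nlinarith
    exact this.trans hl_e2
  have hl_1 : 1 ≤ lam := by linarith
  have hl_0 : 0 < lam := by linarith
  have hloglam : 2 ≤ Real.log lam := by
    rw [← Real.log_exp 2]; exact Real.log_le_log (Real.exp_pos 2) hl_e2
  have hLexp : (L : ℝ) = Real.exp lam := by rw [hlam, Real.exp_log hL0]
  -- thresholds in `X`
  have hX₁ : X₁ ≤ X := ((le_max_left _ _).trans (le_max_left _ _)).trans hXs
  have hX₂ : X₂ ≤ X := ((le_max_right _ _).trans (le_max_left _ _)).trans hXs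
  have hXe : Real.exp 5776 ≤ X := (le_max_right _ _).trans hXs
  have hX0 : 0 < X := (Real.exp_pos _).trans_le hXe
  set u : ℝ := Real.log X with hu
  have hu5776 : 5776 ≤ u := by
    rw [hu, ← Real.log_exp 5776]; exact Real.log_le_log (Real.exp_pos _) hXe
  have hu16 : 16 ≤ u := by linarith
  have hu1 : 1 ≤ u := by linarith
  have hu0 : 0 < u := by linarith
  have hXexp : X = Real.exp u := by rw [hu, Real.exp_log hX0]
  obtain ⟨hr1, hr2, hr3⟩ := rpow_small_le_sqrt hu16
  -- `W = λ⁵`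
  set W : ℝ := lam ^ 5 with hW
  have hW1 : 1 ≤ W := one_le_pow₀ hl_1
  have hl_W' : lam ≤ W := le_self_pow₀ hl_1 (by norm_num)
  have hV₀ : W₁ ≤ lam := (le_max_left _ _).trans hl_W
  have hW3 : 3 ≤ W := hl_3.trans hl_W'
  have hW0 : 0 < W := by linarith
  -- the hypotheses of Theorem 2.3 (`keyEstimate_typ` with `V = λ`)
  have hV1015 : lam ^ 1015 ≤ (L : ℝ) := by
    have : 0 ≤ lam ^ 1015 := by positivity
    linarith
  have hl_u : lam ≤ u ^ (1 / 625 : ℝ) := hLX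
  have hWu : lam ^ 5 ≤ u ^ (1 / 125 : ℝ) := by
    have : (u ^ (1 / 625 : ℝ)) ^ 5 = u ^ (1 / 125 : ℝ) := by
      rw [← Real.rpow_natCast, ← Real.rpow_mul hu0.le]; norm_num
    rw [← this]
    exact pow_le_pow_left₀ hl_0.le hl_u 5
  have hLW15 : (L : ℝ) * lam ^ 75 ≤ X := by
    -- `log (L λ^75) = λ + 75 log λ ≤ 4 λ ≤ 4 u^{1/625} ≤ u`
    have e1 : (L : ℝ) * lam ^ 75 = Real.exp (lam + 75 * Real.log lam) := by
      rw [Real.exp_add, ← hLexp,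
        show (75 : ℝ) * Real.log lam = Real.log (lam ^ 75) by rw [Real.log_pow]; norm_num,
        Real.exp_log (by positivity)]
    rw [e1, hXexp, Real.exp_le_exp]
    have h1 : Real.log lam ≤ lam / 30 := by
      have := hl_30; rw [hlam] at this ⊢; linarith
    nlinarith
  have hLexp2 : (L : ℝ) ≤ Real.exp (Real.sqrt (Real.log X / 2)) := by
    rw [hLexp, Real.exp_le_exp, ← hu]
    exact hl_u.trans hr3
  have hM3 : 15 * Real.log lam ≤ Sieve.nonpretentiousness g X (lam ^ 5) := by
    have := hM; rwa [hlam] at *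
  have hT := hkey X X₃ lam L α g hgm hg1 hX₁ hXX₃ hX₃ hV₀ (by rw [hu] at hWu; exact hWu) hV1015
    hLW15 hLexp2 (by rw [hlam]) hM3
  -- Lemma 2.2 for the non-typical integers `≤ X₃`
  have hX₃1 : (1 : ℝ) ≤ X₃ := le_trans (by linarith [Real.add_one_le_exp (5776 : ℝ)]) (hXe.trans hXX₃)
  have hX₃0 : (0 : ℝ) < X₃ := by linarith
  have hLX' : (L : ℝ) ≤ X := by
    have : (L : ℝ) ≤ L * lam ^ 75 := le_mul_of_one_le_right hL0.le (one_le_pow₀ hl_1)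
    exact this.trans hLW15
  have hP10 : (10 : ℝ) < W ^ 200 := by
    calc (10 : ℝ) < 3 ^ 3 := by norm_num
      _ ≤ W ^ 3 := pow_le_pow_left₀ (by norm_num) hW3 3
      _ ≤ W ^ 200 := pow_le_pow_right₀ hW1 (by norm_num)
  have hPQ : W ^ 200 < (L : ℝ) / W ^ 3 := by
    rw [lt_div_iff₀ (by positivity)]
    calc W ^ 200 * W ^ 3 = W ^ 203 := by ring
      _ < (L : ℝ) := by
          rw [hW, ← pow_mul]; norm_num
          have : 0 < lam ^ 1015 := by positivity
          linarith
  have hQX₃ : (L : ℝ) / W ^ 3 ≤ X₃ := (div_le_self hL0.le (one_le_pow₀ hW1)).trans (hLX'.trans hXX₃)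
  have hsqrt : Real.sqrt X₃ ≤ X₃ := by
    rw [Real.sqrt_le_left (by linarith)]
    nlinarith
  have hQX₀ : (L : ℝ) / W ^ 3 ≤ Real.exp (Real.sqrt (Real.log (Real.sqrt X₃))) := by
    rw [Real.log_sqrt hX₃0.le]
    calc (L : ℝ) / W ^ 3 ≤ L := div_le_self hL0.le (one_le_pow₀ hW1)
      _ ≤ Real.exp (Real.sqrt (Real.log X / 2)) := hLexp2
      _ ≤ Real.exp (Real.sqrt (Real.log X₃ / 2)) := by
          have := Real.log_le_log hX0 hXX₃
          gcongr
  have hE := h22 X₃ (W ^ 200) (L / W ^ 3) (Real.sqrt X₃) (hX₂.trans hXX₃) hP10 hPQ hQX₃ le_rfl hsqrt hQX₀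
  -- the ratio `log P₁ / log Q₁ ≤ 2000 log λ / λ`
  have hratio : Real.log (W ^ 200) / Real.log ((L : ℝ) / W ^ 3) ≤ 2000 * (Real.log lam / lam) := by
    have e1 : Real.log (W ^ 200) = 1000 * Real.log lam := by
      rw [Real.log_pow, hW, Real.log_pow]; push_cast; ring
    have e2 : Real.log ((L : ℝ) / W ^ 3) = lam - 15 * Real.log lam := by
      rw [Real.log_div hL0.ne' (by positivity), hW, ← pow_mul, Real.log_pow, ← hlam]
      push_cast; ring
    rw [e1, e2]
    have h30 : 30 * Real.log lam ≤ lam := by have := hl_30; rwa [hlam] at this ⊢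
    have hden : lam / 2 ≤ lam - 15 * Real.log lam := by linarith
    have hlog0 : 0 ≤ Real.log lam := by linarith
    calc 1000 * Real.log lam / (lam - 15 * Real.log lam) ≤ 1000 * Real.log lam / (lam / 2) :=
          div_le_div_of_nonneg_left (by positivity) (by positivity) hden
      _ = 2000 * (Real.log lam / lam) := by field_simp; ring
  -- decomposition `g = 1_𝒮 g + 1_{𝒮ᶜ} g` window by window
  set N : ℕ := ⌊X₃⌋₊ with hN
  set S : Finset ℕ := typicalSet (W ^ 200) ((L : ℝ) / W ^ 3) (Real.sqrt X₃) X₃ with hSdef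
  have hwin : ∀ x ∈ range (N + 1), ‖∑ n ∈ Ioc x (x + L), g n * (𝐞 (α * n) : ℂ)‖ ≤
      ‖∑ n ∈ Ioc x (x + L), typFun g (W ^ 200) (L / W ^ 3) (Real.sqrt X₃) X₃ n * (𝐞 (α * n) : ℂ)‖ +
        ((#((Ioc x (x + L)).filter (fun n => N < n)) : ℝ) +
          #((Ioc x (x + L)).filter (fun n => n ≤ N ∧
            ¬ IsTypical (W ^ 200) ((L : ℝ) / W ^ 3) (Real.sqrt X₃) n))) := by
    intro x _
    have e : ∑ n ∈ Ioc x (x + L), g n * (𝐞 (α * n) : ℂ) =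
        ∑ n ∈ Ioc x (x + L), typFun g (W ^ 200) (L / W ^ 3) (Real.sqrt X₃) X₃ n * (𝐞 (α * n) : ℂ) +
        ∑ n ∈ Ioc x (x + L), (if n ∈ S then 0 else g n) * (𝐞 (α * n) : ℂ) := by
      rw [← Finset.sum_add_distrib]
      refine Finset.sum_congr rfl fun n _ => ?_
      simp only [typFun, ← hSdef]
      split_ifs <;> ring
    rw [e]
    refine (norm_add_le _ _).trans (add_le_add le_rfl ?_)
    rw [Finset.card_filter, Finset.card_filter]
    push_cast
    rw [← Finset.sum_add_distrib]
    refine (norm_sum_le _ _).trans (Finset.sum_le_sum fun n hn => ?_)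
    rw [Finset.mem_Ioc] at hn
    by_cases hS : n ∈ S
    · simp only [hS, if_true, zero_mul, norm_zero]
      positivity
    · rw [if_neg hS, norm_mul]
      have h1 : ‖g n‖ * ‖(𝐞 (α * n) : ℂ)‖ ≤ 1 :=
        mul_le_one₀ (hg1 n) (norm_nonneg _) (norm_fourierChar_le_one _)
      have h2 : (1 : ℝ) ≤ (if N < n then 1 else 0) + (if n ≤ N ∧
          ¬ IsTypical (W ^ 200) ((L : ℝ) / W ^ 3) (Real.sqrt X₃) n then 1 else 0) := by
        by_cases hNn : N < n
        · rw [if_pos hNn]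
          have : (0 : ℝ) ≤ (if n ≤ N ∧ ¬ IsTypical (W ^ 200) ((L : ℝ) / W ^ 3) (Real.sqrt X₃) n
            then 1 else 0) := by positivity
          linarith
        · push Not at hNn
          have hnt : ¬ IsTypical (W ^ 200) ((L : ℝ) / W ^ 3) (Real.sqrt X₃) n := by
            intro ht
            exact hS (mem_typicalSet.mpr ⟨⟨by omega, hNn⟩, ht⟩)
          rw [if_neg (not_lt.mpr hNn), if_pos ⟨hNn, hnt⟩]
          norm_num
      linarith
  -- summing over `x`
  have hL2 : ((L : ℝ)) ^ 2 ≤ L * X₃ / lam := by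
    rw [le_div_iff₀ hl_0, sq, mul_assoc]
    refine mul_le_mul_of_nonneg_left ?_ hL0.le
    calc (L : ℝ) * lam ≤ L * lam ^ 75 :=
          mul_le_mul_of_nonneg_left (le_self_pow₀ hl_1 (by norm_num)) hL0.le
      _ ≤ X := hLW15
      _ ≤ X₃ := hXX₃
  have hlogdiv : 1 / lam ≤ Real.log lam / lam :=
    div_le_div_of_nonneg_right (by linarith) hl_0.le
  calc ∑ x ∈ range (N + 1), ‖∑ n ∈ Ioc x (x + L), g n * (𝐞 (α * n) : ℂ)‖
      ≤ ∑ x ∈ range (N + 1), (‖∑ n ∈ Ioc x (x + L),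
          typFun g (W ^ 200) (L / W ^ 3) (Real.sqrt X₃) X₃ n * (𝐞 (α * n) : ℂ)‖ +
        ((#((Ioc x (x + L)).filter (fun n => N < n)) : ℝ) +
          #((Ioc x (x + L)).filter (fun n => n ≤ N ∧
            ¬ IsTypical (W ^ 200) ((L : ℝ) / W ^ 3) (Real.sqrt X₃) n)))) := Finset.sum_le_sum hwin
    _ ≤ C₁ * L * X₃ / lam + ((L : ℝ) ^ 2 +
        L * (C₂ * (Real.log (W ^ 200) / Real.log ((L : ℝ) / W ^ 3)) * X₃)) := by
        rw [Finset.sum_add_distrib, Finset.sum_add_distrib]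
        refine add_le_add hT (add_le_add
          (sum_card_overshoot_le N L) ((sum_card_not_typical_le _ _ _ N L).trans
            (mul_le_mul_of_nonneg_left hE (Nat.cast_nonneg L))))
    _ ≤ C₁ * L * X₃ / lam + (L * X₃ / lam + L * (C₂ * (2000 * (Real.log lam / lam)) * X₃)) := by
        gcongr
    _ ≤ (C₁ + 2000 * C₂ + 1) * L * X₃ * (Real.log lam / lam) := by
        have h0 : 0 ≤ (L : ℝ) * X₃ := by positivity
        have k1 := mul_le_mul_of_nonneg_left hlogdiv h0
        have k2 := mul_le_mul_of_nonneg_left hlogdiv (mul_nonneg hC₁.le h0)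
        have e : (C₁ + 2000 * C₂ + 1) * L * X₃ * (Real.log lam / lam) =
            C₁ * (L * X₃) * (Real.log lam / lam) + 2000 * C₂ * (L * X₃) * (Real.log lam / lam) +
              L * X₃ * (Real.log lam / lam) := by ring
        rw [e]
        have e2 : C₁ * L * X₃ / lam = C₁ * (L * X₃) * (1 / lam) := by ring
        have e3 : (L : ℝ) * X₃ / lam = L * X₃ * (1 / lam) := by ring
        have e4 : (L : ℝ) * (C₂ * (2000 * (Real.log lam / lam)) * X₃) =
            2000 * C₂ * (L * X₃) * (Real.log lam / lam) := by ring
        rw [e2, e3, e4]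
        linarith

/-! ## Splitting long windows into balanced pieces

For `H > H₀` the paper covers `[0, H]` by `O(H/H₀)` intervals of length `H₀`; in the discrete
setting a window `(a, a + t]` is split into `m` consecutive pieces of lengths `⌊t/m⌋` and
`⌊t/m⌋ + 1`. -/

/-- Consecutive decomposition: `∑_{e(0) < n ≤ e(m)} f(n) = ∑_{i<m} ∑_{e(i) < n ≤ e(i+1)} f(n)` for a
monotone sequence of endpoints. [folklore] -/
theorem sum_Ioc_eq_sum_pieces (f : ℕ → ℂ) {e : ℕ → ℕ} (he : Monotone e) (m : ℕ) :
    ∑ n ∈ Ioc (e 0) (e m), f n = ∑ i ∈ range m, ∑ n ∈ Ioc (e i) (e (i + 1)), f n := by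
  induction m with
  | zero => simp
  | succ m ih =>
    rw [Finset.sum_range_succ, ← ih,
      Finset.sum_Ioc_consecutive f (he (Nat.zero_le m)) (he (Nat.le_succ m))]

/-- The balanced endpoints `e(i) = i ⌊t/m⌋ + min(i, t mod m)`. [folklore] -/
def pieceEnd (t m i : ℕ) : ℕ := i * (t / m) + min i (t % m)

/-- `e(0) = 0`. [folklore] -/
theorem pieceEnd_zero (t m : ℕ) : pieceEnd t m 0 = 0 := by simp [pieceEnd]

/-- `e(m) = t` (`m ≥ 1`). [folklore] -/
theorem pieceEnd_self {t m : ℕ} (hm : 0 < m) : pieceEnd t m m = t := by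
  unfold pieceEnd
  rw [min_eq_right (Nat.mod_lt t hm).le]
  exact Nat.div_add_mod t m

/-- `e` is monotone. [folklore] -/
theorem pieceEnd_mono (t m : ℕ) : Monotone (pieceEnd t m) := by
  intro i j hij
  unfold pieceEnd
  exact Nat.add_le_add (Nat.mul_le_mul_right _ hij) (min_le_min_right _ hij)

/-- The piece lengths are `⌊t/m⌋` or `⌊t/m⌋ + 1`: `e(i+1) = e(i) + ⌊t/m⌋ + 1[i < t mod m]`.
[folklore] -/
theorem pieceEnd_succ (t m i : ℕ) :
    pieceEnd t m (i + 1) = pieceEnd t m i + (t / m + if i < t % m then 1 else 0) := by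
  unfold pieceEnd
  split_ifs with h
  · rw [min_eq_left (by omega : i + 1 ≤ t % m), min_eq_left (by omega : i ≤ t % m)]; ring
  · rw [min_eq_right (by omega : t % m ≤ i + 1), min_eq_right (by omega : t % m ≤ i)]; ring

/-- `e(i) ≤ t` for `i ≤ m`, `m ≥ 1`. [folklore] -/
theorem pieceEnd_le {t m i : ℕ} (hm : 0 < m) (hi : i ≤ m) : pieceEnd t m i ≤ t := by
  have := pieceEnd_mono t m hi
  rwa [pieceEnd_self hm] at this

/-- **Splitting a family of windows into balanced pieces**: if the families of windows of the
two lengths `s ∈ {⌊t/m⌋, ⌊t/m⌋ + 1}` over `y ≤ Y` are bounded by `B`, and `K + t ≤ Y + 1`, then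
`∑_{k < K} |∑_{k < n ≤ k+t} f(n)| ≤ m B`. [cite: MatomakiRadziwillTao2015, §2 (proof of
Theorem 1.7: "Covering `[0,H]` by `O(H/H₀)` intervals of length `H₀`")] -/
theorem family_split_le (f : ℕ → ℂ) {K t m Y : ℕ} (hm : 0 < m) (hY : K + t ≤ Y + 1) {B : ℝ}
    (hB : ∀ s : ℕ, (s = t / m ∨ s = t / m + 1) →
      ∑ y ∈ range (Y + 1), ‖∑ n ∈ Ioc y (y + s), f n‖ ≤ B) :
    ∑ k ∈ range K, ‖∑ n ∈ Ioc k (k + t), f n‖ ≤ m * B := by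
  set e := pieceEnd t m with hedef
  -- each window is the sum of its pieces
  have hk : ∀ k, ‖∑ n ∈ Ioc k (k + t), f n‖ ≤
      ∑ i ∈ range m, ‖∑ n ∈ Ioc (k + e i) (k + e (i + 1)), f n‖ := by
    intro k
    have hmono : Monotone (fun i => k + e i) := fun i j hij => Nat.add_le_add_left (pieceEnd_mono t m hij) k
    have := sum_Ioc_eq_sum_pieces f hmono m
    simp only [hedef, pieceEnd_zero, add_zero, pieceEnd_self hm] at this
    rw [this]
    exact norm_sum_le _ _
  refine (Finset.sum_le_sum fun k _ => hk k).trans ?_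
  rw [Finset.sum_comm]
  -- each piece family is a subfamily of the windows of length `s_i` over `y ≤ Y`
  have hi : ∀ i ∈ range m, ∑ k ∈ range K, ‖∑ n ∈ Ioc (k + e i) (k + e (i + 1)), f n‖ ≤ B := by
    intro i him
    rw [Finset.mem_range] at him
    set s : ℕ := t / m + (if i < t % m then 1 else 0) with hs
    have hsucc : ∀ k, k + e (i + 1) = (k + e i) + s := by
      intro k; rw [hedef, pieceEnd_succ]; ring
    simp_rw [hsucc]
    have hsB := hB s (by rw [hs]; split_ifs <;> simp)
    refine le_trans ?_ hsB
    have hei : e i ≤ t := pieceEnd_le hm him.le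
    rw [← Finset.sum_image (s := range K) (g := fun k => k + e i)
      (f := fun y => ‖∑ n ∈ Ioc y (y + s), f n‖) (fun a _ b _ h => by simpa using h)]
    refine Finset.sum_le_sum_of_subset_of_nonneg ?_ (fun _ _ _ => norm_nonneg _)
    intro y hy
    rw [Finset.mem_image] at hy
    obtain ⟨k, hk, rfl⟩ := hy
    rw [Finset.mem_range] at hk ⊢
    omega
  calc ∑ i ∈ range m, ∑ k ∈ range K, ‖∑ n ∈ Ioc (k + e i) (k + e (i + 1)), f n‖
      ≤ ∑ i ∈ range m, B := Finset.sum_le_sum hi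
    _ = m * B := by rw [Finset.sum_const, card_range, nsmul_eq_mul]

/-! ## From the integral over `x ∈ [0, X]` to families of integer windows

For `k < x ≤ k + 1` the integers of `[x, x + H]` are `(k, k + t]` with `t ∈ {⌊H⌋, ⌊H⌋ + 1}`,
the second value occurring only when `k + ⌊H⌋ + 1 ≤ ⌊X + H⌋`. -/

section Integral

open MeasureTheory

/-- The integrand `x ↦ |∑_{x ≤ n ≤ x+H} c(n)|` is measurable (a function of `(⌈x⌉, ⌊x+H⌋)`).
[folklore] -/
theorem measurable_norm_sum_Icc (c : ℕ → ℂ) (H : ℝ) :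
    Measurable fun x : ℝ => ‖∑ n ∈ Icc ⌈x⌉₊ ⌊x + H⌋₊, c n‖ := by
  have h1 : Measurable fun x : ℝ => (⌈x⌉₊, ⌊x + H⌋₊) :=
    Nat.measurable_ceil.prodMk (Nat.measurable_floor.comp (measurable_id.add_const _))
  exact ((measurable_of_countable (fun p : ℕ × ℕ => ∑ n ∈ Icc p.1 p.2, c n)).comp h1).norm

/-- `|∑_{x ≤ n ≤ x+H} c(n)| ≤ H + 2` for `1`-bounded `c`, `H ≥ 0`. [folklore] -/
theorem norm_sum_Icc_le {c : ℕ → ℂ} (hc : ∀ n, ‖c n‖ ≤ 1) {H : ℝ} (hH : 0 ≤ H) (x : ℝ) :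
    ‖∑ n ∈ Icc ⌈x⌉₊ ⌊x + H⌋₊, c n‖ ≤ H + 2 := by
  have hcard : (#(Icc ⌈x⌉₊ ⌊x + H⌋₊) : ℝ) ≤ H + 2 := by
    rw [Nat.card_Icc]
    have h1 : ⌊x + H⌋₊ + 1 - ⌈x⌉₊ ≤ ⌊H⌋₊ + 2 := by
      rcases lt_or_ge (x + H) 0 with hneg | hpos
      · rw [Nat.floor_of_nonpos hneg.le]; omega
      · have : ((⌊x + H⌋₊ : ℕ) : ℝ) < ⌈x⌉₊ + (⌊H⌋₊ + 1) := by
          calc ((⌊x + H⌋₊ : ℕ) : ℝ) ≤ x + H := Nat.floor_le hpos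
            _ < ⌈x⌉₊ + (⌊H⌋₊ + 1) := by linarith [Nat.le_ceil x, Nat.lt_floor_add_one H]
        have : ⌊x + H⌋₊ < ⌈x⌉₊ + (⌊H⌋₊ + 1) := by exact_mod_cast this
        omega
    calc ((⌊x + H⌋₊ + 1 - ⌈x⌉₊ : ℕ) : ℝ) ≤ ((⌊H⌋₊ + 2 : ℕ) : ℝ) := by exact_mod_cast h1
      _ = (⌊H⌋₊ : ℝ) + 2 := by push_cast; ring
      _ ≤ H + 2 := by linarith [Nat.floor_le hH]
  refine (norm_sum_le _ _).trans ?_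
  refine le_trans (Finset.sum_le_sum fun n _ => hc n) ?_
  simpa using hcard

/-- A window sum of length `t` of a `1`-bounded sequence has norm `≤ t`. [folklore] -/
theorem norm_sum_Ioc_le {c : ℕ → ℂ} (hc : ∀ n, ‖c n‖ ≤ 1) (k t : ℕ) :
    ‖∑ n ∈ Ioc k (k + t), c n‖ ≤ t := by
  refine (norm_sum_le _ _).trans ?_
  refine le_trans (Finset.sum_le_sum fun n _ => hc n) ?_
  simp

/-- **From the integral to integer windows**:
`∫_0^X |∑_{x ≤ n ≤ x+H} c(n)| dx ≤ ∑_{k < ⌈X⌉} (|∑_{k<n≤k+⌊H⌋} c(n)| + 1[k+⌊H⌋+1 ≤ ⌊X+H⌋] |∑_{k<n≤k+⌊H⌋+1} c(n)|)`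
for `c(0) = 0`, `|c| ≤ 1`, `X ≥ 0`, `H ≥ 0`. [folklore] -/
theorem integral_le_sum_windows {c : ℕ → ℂ} (hc0 : c 0 = 0) (hc : ∀ n, ‖c n‖ ≤ 1) {X H : ℝ}
    (hX : 0 ≤ X) (hH : 0 ≤ H) :
    ∫ x in (0 : ℝ)..X, ‖∑ n ∈ Icc ⌈x⌉₊ ⌊x + H⌋₊, c n‖ ≤
      ∑ k ∈ range ⌈X⌉₊, (‖∑ n ∈ Ioc k (k + ⌊H⌋₊), c n‖ +
        if k + ⌊H⌋₊ + 1 ≤ ⌊X + H⌋₊ then ‖∑ n ∈ Ioc k (k + ⌊H⌋₊ + 1), c n‖ else 0) := by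
  set t₀ : ℕ := ⌊H⌋₊ with ht₀
  set K : ℕ := ⌈X⌉₊ with hK
  set Φ : ℕ → ℝ := fun k => ‖∑ n ∈ Ioc k (k + t₀), c n‖ +
    (if k + t₀ + 1 ≤ ⌊X + H⌋₊ then ‖∑ n ∈ Ioc k (k + t₀ + 1), c n‖ else 0) with hΦ
  set f : ℝ → ℝ := fun x => ‖∑ n ∈ Icc ⌈x⌉₊ ⌊x + H⌋₊, c n‖ with hf
  set φ : ℝ → ℝ := fun x => Φ (⌈x⌉₊ - 1) with hφ
  have hΦ0 : ∀ k, 0 ≤ Φ k := fun k => by rw [hΦ]; positivity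
  have hΦle : ∀ k, Φ k ≤ 2 * H + 1 := by
    intro k
    have h1 := norm_sum_Ioc_le hc k t₀
    have h2 := norm_sum_Ioc_le hc k (t₀ + 1)
    have ht : (t₀ : ℝ) ≤ H := Nat.floor_le hH
    rw [hΦ]; dsimp only
    have h2' : ‖∑ n ∈ Ioc k (k + t₀ + 1), c n‖ ≤ (t₀ : ℝ) + 1 := by
      rw [add_assoc]; exact_mod_cast h2
    split_ifs
    · linarith
    · linarith
  -- measurability and integrability
  have hfm : Measurable f := measurable_norm_sum_Icc c H
  have hφm : Measurable φ := (measurable_of_countable (fun k : ℕ => Φ (k - 1))).comp Nat.measurable_ceil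
  have hfi : ∀ a b : ℝ, IntervalIntegrable f volume a b := by
    intro a b
    refine IntegrableOn.intervalIntegrable (Measure.integrableOn_of_bounded (M := H + 2) ?_
      hfm.aestronglyMeasurable (Filter.Eventually.of_forall fun y => ?_))
    · rw [Set.uIcc, Real.volume_Icc]; exact ENNReal.ofReal_ne_top
    · rw [Real.norm_eq_abs, abs_of_nonneg (norm_nonneg _)]
      exact norm_sum_Icc_le hc hH y
  have hφi : ∀ a b : ℝ, IntervalIntegrable φ volume a b := by
    intro a b
    refine IntegrableOn.intervalIntegrable (Measure.integrableOn_of_bounded (M := 2 * H + 1) ?_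
      hφm.aestronglyMeasurable (Filter.Eventually.of_forall fun y => ?_))
    · rw [Set.uIcc, Real.volume_Icc]; exact ENNReal.ofReal_ne_top
    · rw [Real.norm_eq_abs, abs_of_nonneg (hΦ0 _)]
      exact hΦle _
  -- pointwise comparison on `[0, X]`
  have hfφ : ∀ x ∈ Set.Icc 0 X, f x ≤ φ x := by
    intro x hx
    rw [hf, hφ]; dsimp only
    rcases hx.1.eq_or_lt with h0 | hpos
    · -- `x = 0`
      subst h0
      simp only [Nat.ceil_zero, zero_add, zero_tsub]
      have e : ∑ n ∈ Icc 0 t₀, c n = ∑ n ∈ Ioc 0 (0 + t₀), c n := by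
        rw [zero_add, Finset.Icc_eq_cons_Ioc (Nat.zero_le _), Finset.sum_cons, hc0, zero_add]
      rw [← ht₀, e, hΦ]; dsimp only
      linarith [hΦ0 0, norm_nonneg (∑ n ∈ Ioc 0 (0 + t₀), c n),
        (show (0:ℝ) ≤ (if 0 + t₀ + 1 ≤ ⌊X + H⌋₊ then ‖∑ n ∈ Ioc 0 (0 + t₀ + 1), c n‖ else 0)
          by positivity)]
    · set k : ℕ := ⌈x⌉₊ - 1 with hk
      have hceil : ⌈x⌉₊ = k + 1 := by
        have : 0 < ⌈x⌉₊ := Nat.ceil_pos.mpr hpos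
        omega
      have hkx : (k : ℝ) < x ∧ x ≤ (k : ℝ) + 1 := by
        have := (Nat.ceil_eq_iff (Nat.succ_ne_zero k)).mp hceil
        simpa using this
      have hIcc : Icc ⌈x⌉₊ ⌊x + H⌋₊ = Ioc k ⌊x + H⌋₊ := by
        rw [hceil]; ext n; simp only [Finset.mem_Icc, Finset.mem_Ioc]; omega
      have hlow : k + t₀ ≤ ⌊x + H⌋₊ := by
        refine Nat.le_floor ?_
        push_cast
        linarith [Nat.floor_le hH, hkx.1]
      have hup : ⌊x + H⌋₊ < k + t₀ + 2 := by
        refine (Nat.floor_lt (by linarith)).mpr ?_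
        push_cast
        linarith [Nat.lt_floor_add_one H, hkx.2]
      rw [hIcc]
      rcases (show ⌊x + H⌋₊ = k + t₀ ∨ ⌊x + H⌋₊ = k + t₀ + 1 by omega) with h1 | h1
      · rw [h1, hΦ]; dsimp only
        linarith [(show (0:ℝ) ≤ (if k + t₀ + 1 ≤ ⌊X + H⌋₊ then ‖∑ n ∈ Ioc k (k + t₀ + 1), c n‖ else 0)
          by positivity)]
      · have hind : k + t₀ + 1 ≤ ⌊X + H⌋₊ := by
          rw [← h1]; exact Nat.floor_le_floor (by linarith [hx.2])
        rw [h1, hΦ]; dsimp only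
        rw [if_pos hind]
        linarith [norm_nonneg (∑ n ∈ Ioc k (k + t₀), c n)]
  -- the chain of integral inequalities
  have hXK : X ≤ K := Nat.le_ceil X
  calc ∫ x in (0 : ℝ)..X, f x ≤ ∫ x in (0 : ℝ)..X, φ x :=
        intervalIntegral.integral_mono_on hX (hfi 0 X) (hφi 0 X) hfφ
    _ ≤ ∫ x in (0 : ℝ)..K, φ x :=
        intervalIntegral.integral_mono_interval le_rfl hX hXK
          (Filter.Eventually.of_forall fun x => hΦ0 _) (hφi 0 K)
    _ = ∑ k ∈ range K, ∫ x in (k : ℝ)..((k + 1 : ℕ) : ℝ), φ x := by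
        rw [intervalIntegral.sum_integral_adjacent_intervals (a := fun k : ℕ => (k : ℝ))
          (fun k _ => hφi k _)]
        simp
    _ ≤ ∑ k ∈ range K, Φ k := by
        refine Finset.sum_le_sum fun k _ => ?_
        have hconst : ∀ x ∈ Set.uIoc (k : ℝ) ((k + 1 : ℕ) : ℝ), ‖φ x‖ ≤ Φ k := by
          intro x hx
          rw [Set.uIoc_of_le (by push_cast; linarith)] at hx
          have hceil : ⌈x⌉₊ = k + 1 := by
            rw [Nat.ceil_eq_iff (Nat.succ_ne_zero k)]
            push_cast at hx ⊢
            simpa using hx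
          rw [hφ]; dsimp only
          rw [hceil, Nat.add_sub_cancel, Real.norm_eq_abs, abs_of_nonneg (hΦ0 k)]
        have := intervalIntegral.norm_integral_le_of_norm_le_const hconst
        rw [Real.norm_eq_abs] at this
        push_cast at this
        rw [add_sub_cancel_left, abs_one, mul_one] at this
        push_cast
        exact (le_abs_self _).trans this

end Integral

/-! ## Theorem 1.7 from Theorem A.2

[MRT2015, §2, "Proof of Theorem 1.7 assuming Theorem 2.3"]: with
`log H₀ = min(log^{1/700} X · log log X, exp(M/20) M)`, windows of admissible length are
estimated by `windows_full_le`, longer windows are split into balanced pieces of admissible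
length (`family_split_le`), and the small ranges of `X`, `H`, `M` are covered by the trivial
bound `(H + 1) X`. -/

/-- Threshold: `log u ≤ u^{3/17500}` for `u ≥ U`. [folklore] -/
theorem exists_threshold_u : ∃ U : ℝ, 1 ≤ U ∧ ∀ u : ℝ, U ≤ u → Real.log u ≤ u ^ (3 / 17500 : ℝ) := by
  have h := (isLittleO_log_rpow_rpow_atTop 1 (show (0 : ℝ) < 3 / 17500 by norm_num)).bound
    (show (0 : ℝ) < 1 by norm_num)
  obtain ⟨U, hU⟩ := Filter.eventually_atTop.mp (h.and (Filter.eventually_ge_atTop (1 : ℝ)))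
  refine ⟨max U 1, le_max_right _ _, fun u hu => ?_⟩
  obtain ⟨h1, h2⟩ := hU u ((le_max_left _ _).trans hu)
  rw [Real.rpow_one, one_mul, Real.norm_of_nonneg (Real.log_nonneg h2),
    Real.norm_of_nonneg (Real.rpow_nonneg (by linarith) _)] at h1
  exact h1

/-- Threshold: `60 log M ≤ M` for `M ≥ M₀`. [folklore] -/
theorem exists_threshold_M : ∃ M₀ : ℝ, ∀ M : ℝ, M₀ ≤ M → 60 * Real.log M ≤ M := by
  have ht := Real.tendsto_pow_log_div_mul_add_atTop 1 0 1 one_ne_zero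
  have he := ht.eventually (gt_mem_nhds (show (0 : ℝ) < 1 / 60 by norm_num))
  obtain ⟨M₀, hM₀⟩ := Filter.eventually_atTop.mp (he.and (Filter.eventually_gt_atTop (0 : ℝ)))
  refine ⟨M₀, fun M hM => ?_⟩
  obtain ⟨h1, h2⟩ := hM₀ M hM
  rw [one_mul, add_zero, pow_one, div_lt_iff₀ h2] at h1
  linarith

/-- **The balanced piece length**: with `m = max(2, ⌈2(t₀+1)/σ⌉)` pieces, a window of length
`t ∈ {t₀, t₀+1}` has pieces of length `s = ⌊t/m⌋` (or `s + 1`) with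
`min(t₀, σ)/6 - 1 ≤ s ≤ min(σ, t)/2`. [folklore] -/
theorem pieces_size {t₀ t m : ℕ} {σ : ℝ} (hσ : 2 ≤ σ) (ht : t₀ ≤ t) (ht' : t ≤ t₀ + 1)
    (hm : m = max 2 ⌈2 * ((t₀ : ℝ) + 1) / σ⌉₊) :
    0 < m ∧ ((t / m : ℕ) : ℝ) ≤ σ / 2 ∧ ((t / m : ℕ) : ℝ) ≤ (t : ℝ) / 2 ∧
      min (t₀ : ℝ) σ / 6 - 1 ≤ ((t / m : ℕ) : ℝ) := by
  have hσ0 : 0 < σ := by linarith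
  have hm2 : 2 ≤ m := by rw [hm]; exact le_max_left _ _
  have hm0 : 0 < m := by omega
  have hm0' : (0 : ℝ) < m := by exact_mod_cast hm0
  set a : ℝ := 2 * ((t₀ : ℝ) + 1) / σ with ha
  have ha0 : 0 < a := by positivity
  have hma : a ≤ m := by
    calc a ≤ ⌈a⌉₊ := Nat.le_ceil a
      _ ≤ m := by rw [hm]; exact_mod_cast le_max_right _ _
  have hdiv_le : ((t / m : ℕ) : ℝ) ≤ (t : ℝ) / m := Nat.cast_div_le
  have hdiv_ge : (t : ℝ) / m - 1 ≤ ((t / m : ℕ) : ℝ) := by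
    have h1 : m * (t / m) + t % m = t := Nat.div_add_mod t m
    have h2 : t % m < m := Nat.mod_lt t hm0
    have h3 : ((m : ℕ) : ℝ) * ((t / m : ℕ) : ℝ) + ((t % m : ℕ) : ℝ) = t := by exact_mod_cast h1
    have h4 : ((t % m : ℕ) : ℝ) < m := by exact_mod_cast h2
    rw [sub_le_iff_le_add, div_le_iff₀ hm0']
    nlinarith
  have ht1 : (t : ℝ) ≤ t₀ + 1 := by exact_mod_cast ht'
  have ht0 : (t₀ : ℝ) ≤ t := by exact_mod_cast ht
  refine ⟨hm0, ?_, ?_, ?_⟩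
  · calc ((t / m : ℕ) : ℝ) ≤ (t : ℝ) / m := hdiv_le
      _ ≤ ((t₀ : ℝ) + 1) / m := div_le_div_of_nonneg_right ht1 hm0'.le
      _ ≤ ((t₀ : ℝ) + 1) / a := div_le_div_of_nonneg_left (by positivity) ha0 hma
      _ = σ / 2 := by rw [ha]; field_simp
  · calc ((t / m : ℕ) : ℝ) ≤ (t : ℝ) / m := hdiv_le
      _ ≤ (t : ℝ) / 2 := div_le_div_of_nonneg_left (Nat.cast_nonneg t) (by norm_num)
          (by exact_mod_cast hm2)
  · refine le_trans ?_ hdiv_ge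
    by_cases hc : ⌈a⌉₊ ≤ 2
    · have hm2' : m = 2 := by rw [hm, max_eq_left hc]
      rw [hm2']
      have : min (t₀ : ℝ) σ ≤ t₀ := min_le_left _ _
      push_cast
      linarith
    · push Not at hc
      have hm' : m = ⌈a⌉₊ := by rw [hm, max_eq_right hc.le]
      have ha2 : 2 < a := by
        have : (2 : ℕ) < ⌈a⌉₊ := hc
        exact_mod_cast (Nat.lt_ceil.mp this)
      have hmub : (m : ℝ) ≤ 3 / 2 * a := by
        have : (m : ℝ) < a + 1 := by rw [hm']; exact Nat.ceil_lt_add_one ha0.le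
        linarith
      have ht₀1 : (1 : ℝ) ≤ t₀ := by
        by_contra h
        push Not at h
        have : (t₀ : ℝ) = 0 := by
          have : t₀ < 1 := by exact_mod_cast h
          exact_mod_cast (show t₀ = 0 by omega)
        rw [ha, this] at ha2
        rw [zero_add, mul_one, lt_div_iff₀ hσ0] at ha2
        linarith
      have h1 : σ / 6 ≤ (t : ℝ) / m := by
        rw [div_le_div_iff₀ (by norm_num) hm0']
        calc σ * m ≤ σ * (3 / 2 * a) := mul_le_mul_of_nonneg_left hmub hσ0.le
          _ = 3 * ((t₀ : ℝ) + 1) := by rw [ha]; field_simp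
          _ ≤ t * 6 := by linarith
      have : min (t₀ : ℝ) σ ≤ σ := min_le_right _ _
      linarith

/-- `e(αn) = exp(2πiαn)`. [folklore] -/
theorem fourierChar_natCast_eq_exp (α : ℝ) (n : ℕ) :
    (𝐞 (α * n) : ℂ) = Complex.exp (2 * Real.pi * Complex.I * (α : ℂ) * (n : ℂ)) := by
  rw [Real.fourierChar_apply]
  congr 1
  push_cast
  ring

/-- The rate `log v / v` is antitone on `[e, ∞)` (Mathlib), convenience form. [folklore] -/
theorem log_div_self_le_of_le {a b : ℝ} (ha : Real.exp 1 ≤ a) (hab : a ≤ b) :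
    Real.log b / b ≤ Real.log a / a :=
  Real.log_div_self_antitoneOn (Set.mem_Ici.mpr ha) (Set.mem_Ici.mpr (ha.trans hab)) hab

/-- `exp 1 ≤ 3` and `log 12 ≤ 3`. [folklore] -/
theorem exp_one_le_three_and_log_twelve : Real.exp 1 ≤ 3 ∧ Real.log 12 ≤ 3 := by
  have h := Real.exp_one_lt_d9
  have h1 : Real.exp 1 ≤ 3 := by norm_num at h ⊢; linarith
  refine ⟨h1, ?_⟩
  rw [Real.log_le_iff_le_exp (by norm_num)]
  have h2 := Real.exp_one_gt_d9
  have : Real.exp 3 = Real.exp 1 * (Real.exp 1 * Real.exp 1) := by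
    rw [← Real.exp_add, ← Real.exp_add]; norm_num
  rw [this]; nlinarith [Real.exp_pos (1:ℝ)]

set_option maxHeartbeats 3200000 in
/-- **Theorem 1.7, main regime** (`X`, `H`, `M` large): the discrete window families of the
integral are `≤ C (e^{-M/20} + log log H / log H + log^{-1/700} X) H X`, where `M` is any lower
bound for `M(g; X, W)` at all levels `1 ≤ W ≤ min(log^{1/125} X, log⁵ H)`.  As printed: the two
window lengths `⌊H⌋, ⌊H⌋ + 1` are split into `m = max(2, ⌈2(⌊H⌋+1)/σ⌉)` balanced pieces,
`log σ = min(log^{1/700} X · log log X, M e^{M/20})`; each piece length `s` is admissible for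
`windows_full_le` (`L₀ ≤ s`, `log s ≤ log^{1/625} X`, `15 log log s ≤ M ≤ M(g; X, log⁵ s)`), and
`log log s / log s ≤ 5 (e^{-M/20} + log log H / log H + log^{-1/700} X)`.
[cite: MatomakiRadziwillTao2015, §2 (proof of Theorem 1.7)] -/
theorem theorem17_mainRegime (hA2 : MatomakiRadziwillTao2015_theoremA2) :
    ∃ C Hh Uh Mh : ℝ, 0 < C ∧ ∀ (g : ArithmeticFunction ℂ), g.IsMultiplicative → (∀ n, ‖g n‖ ≤ 1) →
      ∀ (X H : ℝ), 3 ≤ H → H ≤ X → Hh ≤ H → Uh ≤ Real.log X → ∀ M' : ℝ, Mh ≤ M' →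
      (∀ W : ℝ, 1 ≤ W → W ≤ Real.log X ^ (1 / 125 : ℝ) → W ≤ Real.log H ^ 5 →
        M' ≤ Sieve.nonpretentiousness g X W) →
      ∀ α : ℝ, ∑ k ∈ range ⌈X⌉₊, (‖∑ n ∈ Ioc k (k + ⌊H⌋₊), g n * (𝐞 (α * n) : ℂ)‖ +
          (if k + ⌊H⌋₊ + 1 ≤ ⌊X + H⌋₊ then ‖∑ n ∈ Ioc k (k + ⌊H⌋₊ + 1), g n * (𝐞 (α * n) : ℂ)‖
            else 0)) ≤
        C * (Real.exp (-M' / 20) + Real.log (Real.log H) / Real.log H +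
          1 / Real.log X ^ (1 / 700 : ℝ)) * H * X := by
  obtain ⟨C₀, L₀, Xs, hC₀, hwin⟩ := windows_full_le hA2
  obtain ⟨U₁, hU₁1, hU₁⟩ := exists_threshold_u
  obtain ⟨M₁, hM₁⟩ := exists_threshold_M
  obtain ⟨he3, hlog12⟩ := exp_one_le_three_and_log_twelve
  set Lmin : ℝ := max L₀ 16 with hLmin
  have hLmin16 : (16 : ℝ) ≤ Lmin := le_max_right _ _
  have hLminL₀ : L₀ ≤ Lmin := le_max_left _ _
  set Wreq : ℝ := max (Real.log (12 * Lmin)) 6 with hWreq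
  have hWreq6 : (6 : ℝ) ≤ Wreq := le_max_right _ _
  refine ⟨100 * C₀, Real.exp Wreq, max (max U₁ 16) (max (Real.log Xs) (Real.exp Wreq)),
    max (max M₁ 1) Wreq, by positivity, ?_⟩
  intro g hgm hg1 X H hH3 hHX hHh hUh M' hMh hlevel α
  -- sizes of `X`, `H`, `M'`
  set u : ℝ := Real.log X with hu
  have hX0 : 0 < X := by linarith
  have hXu : X = Real.exp u := by rw [hu, Real.exp_log hX0]
  have hU₁u : U₁ ≤ u := ((le_max_left _ _).trans (le_max_left _ _)).trans hUh
  have hu16 : (16 : ℝ) ≤ u := ((le_max_right _ _).trans (le_max_left _ _)).trans hUh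
  have hu1 : (1 : ℝ) ≤ u := by linarith
  have hu0 : (0 : ℝ) < u := by linarith
  have hlogu : Real.log u ≤ u ^ (3 / 17500 : ℝ) := hU₁ u hU₁u
  have hlogu0 : 0 < Real.log u := Real.log_pos (by linarith)
  have hXsX : Xs ≤ X := by
    rcases le_or_gt Xs 0 with h | h
    · linarith
    · have : Real.log Xs ≤ u := ((le_max_left _ _).trans (le_max_right _ _)).trans hUh
      rw [hu] at this
      exact (Real.log_le_log_iff h hX0).mp this
  have huW : Real.exp Wreq ≤ u := ((le_max_right _ _).trans (le_max_right _ _)).trans hUh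
  have hlogu_W : Wreq ≤ Real.log u := by
    rw [← Real.log_exp Wreq]; exact Real.log_le_log (Real.exp_pos _) huW
  have hH0 : (0 : ℝ) < H := by linarith
  have hlogH : Wreq ≤ Real.log H := by
    rw [← Real.log_exp Wreq]; exact Real.log_le_log (Real.exp_pos _) hHh
  have hlogH6 : (6 : ℝ) ≤ Real.log H := hWreq6.trans hlogH
  have hM₁M : M₁ ≤ M' := ((le_max_left _ _).trans (le_max_left _ _)).trans hMh
  have hM1 : (1 : ℝ) ≤ M' := ((le_max_right _ _).trans (le_max_left _ _)).trans hMh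
  have hM0 : (0 : ℝ) < M' := by linarith
  have hMW : Wreq ≤ M' := (le_max_right _ _).trans hMh
  have hlogM : 60 * Real.log M' ≤ M' := hM₁ M' hM₁M
  -- the cap `σ = exp ℓ₀`
  set ℓX : ℝ := u ^ (1 / 700 : ℝ) * Real.log u with hℓX
  set ℓM : ℝ := M' * Real.exp (M' / 20) with hℓM
  set ℓ₀ : ℝ := min ℓX ℓM with hℓ₀
  set σ : ℝ := Real.exp ℓ₀ with hσ
  have hu700 : 1 ≤ u ^ (1 / 700 : ℝ) := Real.one_le_rpow hu1 (by norm_num)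
  have hℓXW : Wreq ≤ ℓX := hlogu_W.trans (le_mul_of_one_le_left hlogu0.le hu700)
  have hℓMW : Wreq ≤ ℓM := hMW.trans (le_mul_of_one_le_right hM0.le (Real.one_le_exp (by positivity)))
  have hℓ₀W : Wreq ≤ ℓ₀ := le_min hℓXW hℓMW
  have hℓ₀6 : (6 : ℝ) ≤ ℓ₀ := hWreq6.trans hℓ₀W
  have hℓ₀0 : 0 < ℓ₀ := by linarith
  have hσ2 : (2 : ℝ) ≤ σ := by
    rw [hσ]; exact le_trans (by linarith [Real.add_one_le_exp (6:ℝ)]) (Real.exp_le_exp.mpr hℓ₀6)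
  have hσ0 : 0 < σ := by linarith
  have hlogσ : Real.log σ = ℓ₀ := by rw [hσ, Real.log_exp]
  have h12Lmin : Real.log (12 * Lmin) ≤ Wreq := le_max_left _ _
  have hσL : 12 * Lmin ≤ σ := by
    rw [hσ, ← Real.exp_log (show 0 < 12 * Lmin by positivity)]
    exact Real.exp_le_exp.mpr (h12Lmin.trans hℓ₀W)
  have hHL : 12 * Lmin ≤ H := by
    rw [← Real.exp_log (show 0 < 12 * Lmin by positivity), ← Real.exp_log hH0]
    exact Real.exp_le_exp.mpr (h12Lmin.trans hlogH)
  -- `ℓ₀ ≤ ℓX ≤ u^{1/625}`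
  have hℓXu : ℓX ≤ u ^ (1 / 625 : ℝ) := by
    calc ℓX ≤ u ^ (1 / 700 : ℝ) * u ^ (3 / 17500 : ℝ) := mul_le_mul_of_nonneg_left hlogu (by positivity)
      _ = u ^ (1 / 625 : ℝ) := by rw [← Real.rpow_add hu0]; norm_num
  -- the three small quantities
  set E₁ : ℝ := Real.exp (-M' / 20) with hE₁
  set E₂ : ℝ := Real.log (Real.log H) / Real.log H with hE₂
  set E₃ : ℝ := 1 / u ^ (1 / 700 : ℝ) with hE₃
  have hE₁0 : 0 < E₁ := Real.exp_pos _
  have hE₂0 : 0 ≤ E₂ := div_nonneg (Real.log_nonneg (by linarith)) (by linarith)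
  have hE₃0 : 0 < E₃ := by positivity
  -- `log ℓ₀ / ℓ₀ ≤ 2 E₃ + (21/20) E₁`
  have hrateℓ₀ : Real.log ℓ₀ / ℓ₀ ≤ 2 * E₃ + 21 / 20 * E₁ := by
    have hX' : Real.log ℓX / ℓX ≤ 2 * E₃ := by
      have hℓX0 : 0 < ℓX := by positivity
      have h1 : Real.log ℓX ≤ 2 * Real.log u := by
        rw [hℓX, Real.log_mul (by positivity) hlogu0.ne', Real.log_rpow hu0]
        have := Real.log_le_sub_one_of_pos hlogu0
        nlinarith
      calc Real.log ℓX / ℓX ≤ 2 * Real.log u / ℓX := div_le_div_of_nonneg_right h1 hℓX0.le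
        _ = 2 * E₃ := by rw [hℓX, hE₃]; field_simp
    have hM'' : Real.log ℓM / ℓM ≤ 21 / 20 * E₁ := by
      have hℓM0 : 0 < ℓM := by positivity
      have h1 : Real.log ℓM ≤ 21 / 20 * M' := by
        rw [hℓM, Real.log_mul hM0.ne' (Real.exp_pos _).ne', Real.log_exp]
        have := Real.log_le_sub_one_of_pos hM0
        linarith
      calc Real.log ℓM / ℓM ≤ 21 / 20 * M' / ℓM := div_le_div_of_nonneg_right h1 hℓM0.le
        _ = 21 / 20 * E₁ := by
            rw [hℓM, hE₁, show -M' / 20 = -(M' / 20) by ring, Real.exp_neg]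
            field_simp
    have hnonnegX : 0 ≤ Real.log ℓX / ℓX :=
      div_nonneg (Real.log_nonneg (by linarith)) (by linarith)
    have hnonnegM : 0 ≤ Real.log ℓM / ℓM :=
      div_nonneg (Real.log_nonneg (by linarith)) (by linarith)
    rcases min_choice ℓX ℓM with h | h <;> rw [hℓ₀, h] <;> linarith
  -- `w = min (log H) ℓ₀ ≥ 6`, and `log w / w ≤ E₂ + log ℓ₀/ℓ₀`
  set w : ℝ := min (Real.log H) ℓ₀ with hw
  have hw6 : (6 : ℝ) ≤ w := le_min hlogH6 hℓ₀6
  have hratew : Real.log w / w ≤ E₂ + (2 * E₃ + 21 / 20 * E₁) := by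
    have h1 : 0 ≤ Real.log ℓ₀ / ℓ₀ := div_nonneg (Real.log_nonneg (by linarith)) hℓ₀0.le
    rcases min_choice (Real.log H) ℓ₀ with h | h <;> rw [hw, h]
    · rw [← hE₂]; linarith
    · linarith
  -- the rate at any `v ≥ w/2`: `log v / v ≤ 5 E`
  have hrate : ∀ v : ℝ, w / 2 ≤ v → Real.log v / v ≤ 5 * (E₁ + E₂ + E₃) := by
    intro v hv
    have h1 : Real.log v / v ≤ Real.log (w / 2) / (w / 2) :=
      log_div_self_le_of_le (by linarith) hv
    have h2 : Real.log (w / 2) / (w / 2) ≤ 2 * (Real.log w / w) := by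
      have hw0 : 0 < w := by linarith
      have : Real.log (w / 2) ≤ Real.log w := Real.log_le_log (by linarith) (by linarith)
      rw [div_div_eq_mul_div]
      calc Real.log (w / 2) * 2 / w ≤ Real.log w * 2 / w :=
            div_le_div_of_nonneg_right (by nlinarith) hw0.le
        _ = 2 * (Real.log w / w) := by ring
    nlinarith [hE₁0.le, hE₂0, hE₃0.le]
  -- the balanced pieces
  set t₀ : ℕ := ⌊H⌋₊ with ht₀
  have ht₀H : (t₀ : ℝ) ≤ H := Nat.floor_le hH0.le
  have hHt₀ : H < t₀ + 1 := Nat.lt_floor_add_one H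
  set m : ℕ := max 2 ⌈2 * ((t₀ : ℝ) + 1) / σ⌉₊ with hm
  set N : ℕ := ⌊X + H⌋₊ with hN
  -- admissibility and the bound for one piece family
  have hpiece : ∀ t : ℕ, t₀ ≤ t → t ≤ t₀ + 1 → ∀ s : ℕ, (s = t / m ∨ s = t / m + 1) →
      ∑ y ∈ range (N + 1), ‖∑ n ∈ Ioc y (y + s), g n * (𝐞 (α * n) : ℂ)‖ ≤
        20 * C₀ * ((t / m : ℕ) : ℝ) * X * (E₁ + E₂ + E₃) := by
    intro t ht ht' s hs
    obtain ⟨hm0, hsσ, hst, hslow⟩ := pieces_size hσ2 ht ht' hm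
    set s₀ : ℕ := t / m with hs₀
    -- `s₀ ≥ min(H, σ)/12 ≥ Lmin`
    have hmin : min H σ / 12 ≤ (s₀ : ℝ) := by
      have h1 : min H σ - 1 ≤ min (t₀ : ℝ) σ := by
        rcases min_choice (t₀ : ℝ) σ with h | h <;> rw [h]
        · linarith [min_le_left H σ]
        · linarith [min_le_right H σ]
      have h2 : 12 * Lmin ≤ min H σ := le_min hHL hσL
      have : (14 : ℝ) ≤ min H σ := by linarith
      linarith
    have hs₀L : Lmin ≤ (s₀ : ℝ) := by
      have : 12 * Lmin ≤ min H σ := le_min hHL hσL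
      linarith
    have hs₀16 : (16 : ℝ) ≤ s₀ := hLmin16.trans hs₀L
    have hs₀0 : (0 : ℝ) < s₀ := by linarith
    -- `s` versus `s₀`
    have hss₀ : (s₀ : ℝ) ≤ s ∧ (s : ℝ) ≤ s₀ + 1 := by
      rcases hs with rfl | rfl
      · exact ⟨le_rfl, by linarith⟩
      · push_cast; exact ⟨by linarith, le_rfl⟩
    have hs16 : (16 : ℝ) ≤ s := hs₀16.trans hss₀.1
    have hs0 : (0 : ℝ) < s := by linarith
    have hsL₀ : L₀ ≤ (s : ℝ) := hLminL₀.trans (hs₀L.trans hss₀.1)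
    have hsσ' : (s : ℝ) ≤ σ := by linarith [hss₀.2]
    have hsH : (s : ℝ) ≤ H := by
      have : (t : ℝ) ≤ t₀ + 1 := by exact_mod_cast ht'
      linarith [hss₀.2]
    -- `log s ≤ ℓ₀ ≤ u^{1/625}`
    have hlogs : Real.log s ≤ ℓ₀ := by
      rw [← hlogσ]; exact Real.log_le_log hs0 hsσ'
    have hlogs1 : 1 ≤ Real.log s := by
      have : Real.exp 1 ≤ s := by linarith
      rw [← Real.log_exp 1]; exact Real.log_le_log (Real.exp_pos 1) this
    have hlogs_u : Real.log s ≤ u ^ (1 / 625 : ℝ) := hlogs.trans ((min_le_left _ _).trans hℓXu)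
    -- the level `W = log⁵ s`
    have hW1 : (1 : ℝ) ≤ Real.log s ^ 5 := one_le_pow₀ hlogs1
    have hWu : Real.log s ^ 5 ≤ u ^ (1 / 125 : ℝ) := by
      have : (u ^ (1 / 625 : ℝ)) ^ 5 = u ^ (1 / 125 : ℝ) := by
        rw [← Real.rpow_natCast, ← Real.rpow_mul hu0.le]; norm_num
      rw [← this]
      exact pow_le_pow_left₀ (by linarith) hlogs_u 5
    have hWH : Real.log s ^ 5 ≤ Real.log H ^ 5 :=
      pow_le_pow_left₀ (by linarith) (Real.log_le_log hs0 hsH) 5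
    have hMlevel : M' ≤ Sieve.nonpretentiousness g X (Real.log s ^ 5) := hlevel _ hW1 hWu hWH
    have hloglog : 15 * Real.log (Real.log s) ≤ Sieve.nonpretentiousness g X (Real.log s ^ 5) := by
      refine le_trans ?_ hMlevel
      have h1 : Real.log (Real.log s) ≤ Real.log ℓ₀ := Real.log_le_log (by linarith) hlogs
      have h2 : Real.log ℓ₀ ≤ Real.log ℓM := Real.log_le_log hℓ₀0 (min_le_right _ _)
      have h3 : Real.log ℓM = Real.log M' + M' / 20 := by
        rw [hℓM, Real.log_mul hM0.ne' (Real.exp_pos _).ne', Real.log_exp]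
      linarith
    -- Layer A for `s`
    have hXH : X ≤ X + H := by linarith
    have hXH2 : X + H ≤ 2 * X := by linarith
    have hA := hwin X (X + H) s α g hgm hg1 hXsX hXH hXH2 hsL₀ hlogs_u hloglog
    -- the rate at `s`
    have hrate_s : Real.log (Real.log s) / Real.log s ≤ 5 * (E₁ + E₂ + E₃) := by
      refine hrate _ ?_
      -- `log s ≥ log s₀ ≥ log (min H σ / 12) = log (min H σ) - log 12 ≥ w - 3 ≥ w/2`
      have h1 : Real.log (min H σ / 12) ≤ Real.log s :=
        Real.log_le_log (by positivity) (hmin.trans hss₀.1)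
      have h2 : Real.log (min H σ / 12) = Real.log (min H σ) - Real.log 12 :=
        Real.log_div (by positivity) (by norm_num)
      have h3 : w ≤ Real.log (min H σ) := by
        rcases min_choice H σ with h | h <;> rw [h]
        · exact min_le_left _ _
        · rw [hlogσ]; exact min_le_right _ _
      linarith
    calc ∑ y ∈ range (N + 1), ‖∑ n ∈ Ioc y (y + s), g n * (𝐞 (α * n) : ℂ)‖
        ≤ C₀ * s * (X + H) * (Real.log (Real.log s) / Real.log s) := hA
      _ ≤ C₀ * (2 * s₀) * (2 * X) * (5 * (E₁ + E₂ + E₃)) := by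
          have h0 : 0 ≤ Real.log (Real.log s) / Real.log s :=
            div_nonneg (Real.log_nonneg hlogs1) (by linarith)
          have h1 : (s : ℝ) ≤ 2 * s₀ := by linarith [hss₀.2]
          have h2 : C₀ * s * (X + H) ≤ C₀ * (2 * s₀) * (2 * X) := by
            apply mul_le_mul (mul_le_mul_of_nonneg_left h1 hC₀.le) hXH2 (by positivity) (by positivity)
          exact mul_le_mul h2 hrate_s h0 (by positivity)
      _ = 20 * C₀ * (s₀ : ℝ) * X * (E₁ + E₂ + E₃) := by ring
  -- the two families
  have hm0 : 0 < m := by rw [hm]; exact lt_of_lt_of_le (by norm_num) (le_max_left _ _)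
  have hfam : ∀ t K : ℕ, t₀ ≤ t → t ≤ t₀ + 1 → K + t ≤ N + 1 →
      ∑ k ∈ range K, ‖∑ n ∈ Ioc k (k + t), g n * (𝐞 (α * n) : ℂ)‖ ≤
        20 * C₀ * t * X * (E₁ + E₂ + E₃) := by
    intro t K ht ht' hK
    have h := family_split_le (fun n => g n * (𝐞 (α * n) : ℂ)) hm0 hK
      (B := 20 * C₀ * ((t / m : ℕ) : ℝ) * X * (E₁ + E₂ + E₃)) (fun s hs => hpiece t ht ht' s hs)
    refine h.trans ?_
    have hms : (m : ℝ) * ((t / m : ℕ) : ℝ) ≤ t := by exact_mod_cast Nat.mul_div_le t m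
    have h0 : 0 ≤ 20 * C₀ * X * (E₁ + E₂ + E₃) := by positivity
    calc (m : ℝ) * (20 * C₀ * ((t / m : ℕ) : ℝ) * X * (E₁ + E₂ + E₃))
        = (m * ((t / m : ℕ) : ℝ)) * (20 * C₀ * X * (E₁ + E₂ + E₃)) := by ring
      _ ≤ t * (20 * C₀ * X * (E₁ + E₂ + E₃)) := mul_le_mul_of_nonneg_right hms h0
      _ = 20 * C₀ * t * X * (E₁ + E₂ + E₃) := by ring
  -- family 1: `t = t₀`, `K = ⌈X⌉`
  have hK1 : ⌈X⌉₊ + t₀ ≤ N + 1 := by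
    have h1 : (⌈X⌉₊ : ℝ) < X + 1 := Nat.ceil_lt_add_one hX0.le
    have h2 : X + H < (N : ℝ) + 1 := Nat.lt_floor_add_one (X + H)
    have : ((⌈X⌉₊ + t₀ : ℕ) : ℝ) < (N : ℝ) + 2 := by push_cast; linarith
    have : ⌈X⌉₊ + t₀ < N + 2 := by exact_mod_cast this
    omega
  have hF1 := hfam t₀ ⌈X⌉₊ le_rfl (Nat.le_succ _) hK1
  -- family 2: `t = t₀ + 1`, `K = N - t₀`
  have ht₀N : t₀ ≤ N := Nat.floor_le_floor (by linarith)
  have hK2 : (N - t₀) + (t₀ + 1) ≤ N + 1 := by omega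
  have hF2 := hfam (t₀ + 1) (N - t₀) (Nat.le_succ _) le_rfl hK2
  have hF2' : ∑ k ∈ range ⌈X⌉₊, (if k + t₀ + 1 ≤ N then
      ‖∑ n ∈ Ioc k (k + t₀ + 1), g n * (𝐞 (α * n) : ℂ)‖ else 0) ≤
      20 * C₀ * ((t₀ + 1 : ℕ) : ℝ) * X * (E₁ + E₂ + E₃) := by
    refine le_trans ?_ hF2
    rw [← Finset.sum_filter]
    simp_rw [add_assoc]
    refine Finset.sum_le_sum_of_subset_of_nonneg ?_ (fun _ _ _ => norm_nonneg _)
    intro k hk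
    rw [Finset.mem_filter] at hk
    rw [Finset.mem_range]; omega
  -- conclusion
  have hE : 0 ≤ E₁ + E₂ + E₃ := by positivity
  calc ∑ k ∈ range ⌈X⌉₊, (‖∑ n ∈ Ioc k (k + t₀), g n * (𝐞 (α * n) : ℂ)‖ +
        (if k + t₀ + 1 ≤ N then ‖∑ n ∈ Ioc k (k + t₀ + 1), g n * (𝐞 (α * n) : ℂ)‖ else 0))
      ≤ 20 * C₀ * t₀ * X * (E₁ + E₂ + E₃) + 20 * C₀ * ((t₀ + 1 : ℕ) : ℝ) * X * (E₁ + E₂ + E₃) := by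
        rw [Finset.sum_add_distrib]; exact add_le_add hF1 hF2'
    _ = 20 * C₀ * X * (E₁ + E₂ + E₃) * (2 * t₀ + 1) := by push_cast; ring
    _ ≤ 20 * C₀ * X * (E₁ + E₂ + E₃) * (3 * H) := by
        refine mul_le_mul_of_nonneg_left ?_ (by positivity)
        have h1 : (t₀ : ℝ) ≤ H := ht₀H
        have h2 : (3 : ℝ) ≤ H := hH3
        linarith
    _ = 60 * C₀ * (E₁ + E₂ + E₃) * H * X := by ring
    _ ≤ 100 * C₀ * (E₁ + E₂ + E₃) * H * X := by
        have : 0 ≤ C₀ * (E₁ + E₂ + E₃) * H * X := by positivity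
        nlinarith

/-- `exp 2 ≤ 10`, so `log H ≥ 2` for `H ≥ 10`. [folklore] -/
theorem two_le_log_of_ten_le {H : ℝ} (hH : 10 ≤ H) : 2 ≤ Real.log H := by
  have h := Real.exp_one_lt_d9
  have e : Real.exp 2 = Real.exp 1 * Real.exp 1 := by rw [← Real.exp_add]; norm_num
  have h10 : Real.exp 2 ≤ 10 := by rw [e]; nlinarith [Real.exp_pos (1:ℝ)]
  rw [← Real.log_exp 2]
  exact Real.log_le_log (Real.exp_pos 2) (h10.trans hH)

set_option maxHeartbeats 1600000 in
/-- **Matomäki–Radziwiłł–Tao 2015, Theorem 1.7, from Theorem A.2.**  The named fact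
`Literature.NumberTheory.LFunctions.MatomakiRadziwillTao2015_theorem17` (the exponential sum
estimate `sup_α ∫_0^X |∑_{x≤n≤x+H} g(n)e(αn)| dx ≪ (e^{-M(g;X,Q)/20} + log log H/log H + log^{-1/700} X) HX`,
`Q = min(log^{1/125} X, log⁵ H)`) follows from the named fact
`Literature.NumberTheory.LFunctions.MatomakiRadziwillTao2015_theoremA2` (the complex
Matomäki–Radziwiłł theorem, [MRT2015, Thm A.2]); everything in between — Lemma 2.2, the minor
arc estimate of §3 (in `L²` form), the major arc estimate of §4, Proposition 2.4, Theorem 2.3 and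
the deduction of §2 — is proved in the tree.  Small `X`, `H` or `M` are covered by the trivial
bound `(H + 2) X`; the main regime is `theorem17_mainRegime` (via `integral_le_sum_windows` and
the monotonicity of `M(g; X, ·)` in the level). [cite: MatomakiRadziwillTao2015, Theorem 1.7] -/
theorem MatomakiRadziwillTao2015_theorem17_of_theoremA2 (hA2 : MatomakiRadziwillTao2015_theoremA2) :
    MatomakiRadziwillTao2015_theorem17 := by
  obtain ⟨C, Hh, Uh, Mh, hC, hmain⟩ := theorem17_mainRegime hA2
  set Hh' : ℝ := max Hh 10 with hHh'
  set Uh' : ℝ := max Uh 16 with hUh'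
  have hHh'10 : (10 : ℝ) ≤ Hh' := le_max_right _ _
  have hUh'16 : (16 : ℝ) ≤ Uh' := le_max_right _ _
  set c₁ : ℝ := 1 / Uh' ^ (1 / 700 : ℝ) with hc₁
  set c₂ : ℝ := Real.log 2 / Real.log Hh' with hc₂
  set c₃ : ℝ := Real.exp (-Mh / 20) with hc₃
  have hc₁0 : 0 < c₁ := by positivity
  have hlogHh' : 0 < Real.log Hh' := Real.log_pos (by linarith)
  have hlog2 : 0 < Real.log 2 := Real.log_pos (by norm_num)
  have hc₂0 : 0 < c₂ := div_pos hlog2 hlogHh'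
  have hc₃0 : 0 < c₃ := Real.exp_pos _
  refine ⟨max C (max (2 / c₁) (max (2 / c₂) (2 / c₃))), ?_⟩
  intro g hgm hg1 X H h10 hHX α
  have hH0 : (0 : ℝ) < H := by linarith
  have hX0 : (0 : ℝ) < X := by linarith
  set u : ℝ := Real.log X with hu
  have hlogH2 : 2 ≤ Real.log H := two_le_log_of_ten_le h10
  have hu2 : 2 ≤ u := (two_le_log_of_ten_le (h10.trans hHX))
  have hu0 : 0 < u := by linarith
  -- the window summand as `g n e(αn)`
  set c : ℕ → ℂ := fun n => g n * (𝐞 (α * n) : ℂ) with hcdef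
  have hc0 : c 0 = 0 := by simp [hcdef]
  have hc1 : ∀ n, ‖c n‖ ≤ 1 := fun n => by
    rw [hcdef]; dsimp only; rw [norm_mul]
    exact mul_le_one₀ (hg1 n) (norm_nonneg _) (norm_fourierChar_le_one _)
  have hconv : ∀ x : ℝ, ‖∑ n ∈ Icc ⌈x⌉₊ ⌊x + H⌋₊,
      g n * Complex.exp (2 * Real.pi * Complex.I * (α : ℂ) * (n : ℂ))‖ =
      ‖∑ n ∈ Icc ⌈x⌉₊ ⌊x + H⌋₊, c n‖ := by
    intro x; congr 1
    exact Finset.sum_congr rfl fun n _ => by rw [hcdef]; dsimp only; rw [fourierChar_natCast_eq_exp]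
  simp_rw [hconv]
  -- the three small quantities
  set Q : ℝ := min (Real.log X ^ (1 / 125 : ℝ)) (Real.log H ^ (5 : ℝ)) with hQ
  set M' : ℝ := Sieve.nonpretentiousness g X Q with hM'
  set E₁ : ℝ := Real.exp (-M' / 20) with hE₁
  set E₂ : ℝ := Real.log (Real.log H) / Real.log H with hE₂
  set E₃ : ℝ := 1 / Real.log X ^ (1 / 700 : ℝ) with hE₃
  have hE₁0 : 0 < E₁ := Real.exp_pos _
  have hE₂0 : 0 ≤ E₂ := div_nonneg (Real.log_nonneg (by linarith)) (by linarith)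
  have hE₃0 : 0 < E₃ := by rw [hE₃, ← hu]; positivity
  have hE : 0 ≤ E₁ + E₂ + E₃ := by positivity
  have hgoal : ∀ {B : ℝ}, ∫ x in (0 : ℝ)..X, ‖∑ n ∈ Icc ⌈x⌉₊ ⌊x + H⌋₊, c n‖ ≤ B * (E₁ + E₂ + E₃) * H * X →
      B ≤ max C (max (2 / c₁) (max (2 / c₂) (2 / c₃))) →
      ∫ x in (0 : ℝ)..X, ‖∑ n ∈ Icc ⌈x⌉₊ ⌊x + H⌋₊, c n‖ ≤
        max C (max (2 / c₁) (max (2 / c₂) (2 / c₃))) * (E₁ + E₂ + E₃) * H * X := by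
    intro B h1 h2
    refine h1.trans ?_
    have : 0 ≤ (E₁ + E₂ + E₃) * H * X := by positivity
    calc B * (E₁ + E₂ + E₃) * H * X = B * ((E₁ + E₂ + E₃) * H * X) := by ring
      _ ≤ max C (max (2 / c₁) (max (2 / c₂) (2 / c₃))) * ((E₁ + E₂ + E₃) * H * X) :=
          mul_le_mul_of_nonneg_right h2 this
      _ = _ := by ring
  -- the trivial bound `∫ ≤ (H + 2) X ≤ 2 H X`
  have htriv : ∫ x in (0 : ℝ)..X, ‖∑ n ∈ Icc ⌈x⌉₊ ⌊x + H⌋₊, c n‖ ≤ 2 * H * X := by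
    have h1 : ∀ x ∈ Set.uIoc (0 : ℝ) X, ‖(‖∑ n ∈ Icc ⌈x⌉₊ ⌊x + H⌋₊, c n‖)‖ ≤ H + 2 := by
      intro x _
      rw [Real.norm_eq_abs, abs_of_nonneg (norm_nonneg _)]
      exact norm_sum_Icc_le hc1 hH0.le x
    have h2 := intervalIntegral.norm_integral_le_of_norm_le_const h1
    rw [sub_zero, abs_of_pos hX0, Real.norm_eq_abs] at h2
    have h3 := (le_abs_self _).trans h2
    nlinarith
  -- small quantities force the trivial bound to suffice
  have hsmall : ∀ {cc : ℝ}, 0 < cc → cc ≤ E₁ + E₂ + E₃ → 2 / cc ≤ max C (max (2 / c₁) (max (2 / c₂) (2 / c₃))) →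
      ∫ x in (0 : ℝ)..X, ‖∑ n ∈ Icc ⌈x⌉₊ ⌊x + H⌋₊, c n‖ ≤
        max C (max (2 / c₁) (max (2 / c₂) (2 / c₃))) * (E₁ + E₂ + E₃) * H * X := by
    intro cc hcc hccE hle
    refine hgoal (htriv.trans ?_) hle
    have hHX0 : 0 ≤ H * X := by positivity
    have e : 2 / cc * (E₁ + E₂ + E₃) * H * X = (2 * H * X) * ((E₁ + E₂ + E₃) / cc) := by
      field_simp
    rw [e]
    refine le_mul_of_one_le_right (by positivity) ?_
    rwa [one_le_div hcc]
  by_cases hXbig : Uh' ≤ u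
  · by_cases hHbig : Hh' ≤ H
    · by_cases hMbig : Mh ≤ M'
      · -- main regime
        have hlevel : ∀ W : ℝ, 1 ≤ W → W ≤ Real.log X ^ (1 / 125 : ℝ) → W ≤ Real.log H ^ 5 →
            M' ≤ Sieve.nonpretentiousness g X W := by
          intro W hW1 hWu hWH
          refine nonpretentiousness_mono_level hg1 hX0.le hW1 (le_min hWu ?_)
          rwa [show (5 : ℝ) = ((5 : ℕ) : ℝ) by norm_num, Real.rpow_natCast]
        have h1 := integral_le_sum_windows hc0 hc1 hX0.le hH0.le (X := X) (H := H)
        have h2 := hmain g hgm hg1 X H (by linarith) hHX ((le_max_left _ _).trans hHbig)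
          ((le_max_left _ _).trans hXbig) M' hMbig hlevel α
        exact hgoal (h1.trans h2) (le_max_left _ _)
      · -- `M'` small: `E₁ ≥ c₃`
        push Not at hMbig
        refine hsmall hc₃0 ?_ ((le_max_right _ _).trans ((le_max_right _ _).trans (le_max_right _ _)))
        have : c₃ ≤ E₁ := by
          rw [hc₃, hE₁]; exact Real.exp_le_exp.mpr (by linarith)
        linarith
    · -- `H` small: `E₂ ≥ c₂`
      push Not at hHbig
      refine hsmall hc₂0 ?_ ((le_max_left _ _).trans ((le_max_right _ _).trans (le_max_right _ _)))
      have hlogH0 : 0 < Real.log H := by linarith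
      have : c₂ ≤ E₂ := by
        rw [hc₂, hE₂]
        calc Real.log 2 / Real.log Hh' ≤ Real.log 2 / Real.log H :=
              div_le_div_of_nonneg_left hlog2.le hlogH0 (Real.log_le_log hH0 hHbig.le)
          _ ≤ Real.log (Real.log H) / Real.log H :=
              div_le_div_of_nonneg_right (Real.log_le_log (by norm_num) hlogH2) hlogH0.le
      linarith
  · -- `X` small: `E₃ ≥ c₁`
    push Not at hXbig
    refine hsmall hc₁0 ?_ ((le_max_left _ _).trans (le_max_right _ _))
    have : c₁ ≤ E₃ := by
      rw [hc₁, hE₃, ← hu]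
      exact div_le_div_of_nonneg_left zero_le_one (by positivity)
        (Real.rpow_le_rpow hu0.le hXbig.le (by norm_num))
    linarith

end MRT2015

end Literature.NumberTheory.LFunctions
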